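import Literature.RingTheory.Flat.FiberProductFreeModule
import Mathlib.Algebra.TrivSqZeroExt.Ideal
import Mathlib.RingTheory.Flat.EquationalCriterion
import Mathlib.RingTheory.AdjoinRoot
import Mathlib.Algebra.Polynomial.Div
import Mathlib.Tactic.IntervalCases
import HarnessLib

/-!
# [Schlessinger1968, Remark p. 217]: Lemma 3.4 is false if neither `A'' → A` nor `A' → A` is surjective

Family `hodge` (computation cell `pub-hsemireg`, LIT-W seat «Pridham / derived deformation theory as printed»), layer
`Literature/RingTheory/Flat`; companion of `FiberProductFreeModule.lean` ([Schlessinger1968, Lemma 3.4]: for a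
cartesian square `B = A' ×_A A''` with `A'' → A` SURJECTIVE with nilpotent kernel, the fibre product `N = M' ×_M M''`
of flat modules satisfying (ii) is flat over `B`, and its projections are base changes). M. Schlessinger, *Functors
of Artin rings*, Trans. AMS 130 (1968), p. 217, AS PRINTED (the Remark after Corollary 3.6):

«REMARK. Lemma 3.4 is false, in general, if neither `A'' → A` nor `A' → A` is assumed surjective. For example, let
`A'` be a sublocal ring of the local ring `A`, and map `A₁ = A''` [sic: `A₁` is `A'`] into `A` by inclusion. Let `a`
be a unit of `A` such that the ideal `(aA') ∩ A'` of `A'` is not flat (= free) over `A'`. (In `C_Λ` one could take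
`A = k[t]/(t³)`, `A' = k[t²]`, `a = 1 + t`.) Let `M' = M'' = A'`, `M = A`, `u'` = inclusion, `u''` = multiplication by
`a⁻¹`. Then `B ≅ A'`, while `N ≅ (aA') ∩ A'` is not flat over `B`.» (`C_Λ` = the Artin local `Λ`-algebras of §1.)

TYPED HERE.
* § The recipe, verbatim, for ANY injective `algebraMap A' A` («`A'` a sub(local) ring of `A`») and ANY unit `a`
  of `A`: `u' = inclusion`, `u'' = mulInclusion a⁻¹` («multiplication by `a⁻¹`»), both semilinear over `A' → A`;
  `B = A' ×_A A' ≅ A'` is realised by taking `R₃ := A'` in `fiberProd` (the square IS cartesian: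
  `cartesian_of_injective`); `N = remarkN a = fiberProd A' u' u''`; the ideal `(aA') ∩ A'` = `remarkIdeal a`;
  **`remarkEquiv : N ≃ₗ[A'] (aA') ∩ A'`** (second projection); the hypotheses of Lemma 3.4 OTHER than (i) hold:
  `M' = M'' = A'` flat (`Module.Flat.self`), (ii) for `u'` and for `u''` as `IsBaseChange`
  (`isBaseChange_inclusion`, `isBaseChange_mulInclusion`); hence **`not_flat_remarkN`**: if `(aA') ∩ A'` is not
  flat over `A'`, the conclusion «`N` is flat over `B`» of Lemma 3.4 FAILS.
* § THE PRINTED INSTANCE (`PrintedExample`): `A = k[t]/(t³)` (`AdjoinRoot (X³)`), `A' = k[t²] = k ⊕ kt²` (the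
  dual numbers `k[ε]`, `ε ↦ t²`, `incl3`; injective, NOT surjective), `a = 1 + t` (`unit3`, inverse `1 − t + t²`):
  `(1 + t)(α + βt²) = α + αt + βt²` lies in `k[t²]` iff `α = 0`, so `(aA') ∩ A' = (t²) = (ε)`
  (`remarkIdeal_printed_eq`, by `AdjoinRoot.mk_eq_mk` + `Polynomial.X_pow_dvd_iff` on coefficients `0, 1, 2`),
  not flat over `k[t²]`; **`not_flat_remarkN_printed`**.
* § A second instance (`Example`) of the SAME mechanism with square-zero algebras, where Mathlib computes by
  components (`TrivSqZeroExt`) and where the non-flatness of `(ε) ⊂ k[ε]` is proved once for both: `A' = k[ε]` (`ε² = 0`), `A = k[x, y]/(x, y)²` (`= TrivSqZeroExt k (k × k)`),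
  `A' ↪ A` by `ε ↦ x` (`TrivSqZeroExt.map (LinearMap.inl k k k)`, injective, NOT surjective, a local
  `k`-subalgebra), `a = 1 + y`: then `a · (α + βε) = α + βx + αy` lies in `A'` iff `α = 0`, so
  `(aA') ∩ A' = (ε) = kerIdeal` (`remarkIdeal_example_eq`), which is NOT flat over `k[ε]`
  (`not_flat_kerIdeal`: `ε · ε = 0` is not a trivial relation — Mathlib's equational criterion
  `Module.Flat.isTrivialRelation_of_sum_smul_eq_zero` — since every coefficient killed by `ε` lies in `(ε)` and
  `(ε) · (ε) = 0 ∌ ε`); hence **`not_flat_remarkN_example`**: this `N` is not flat over `B = k[ε]` although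
  `M'`, `M''` are free of rank one and (ii) holds on both sides — only (i) (surjectivity) fails
  (`not_surjective_incl`). [a folklore instance of the printed recipe, next to the printed one above.]
Definitions with body and theorems; no named fact, no `sorry`.

## References
* [Schlessinger1968] M. Schlessinger, Functors of Artin rings, Trans. AMS 130 (1968): Remark after Cor. 3.6, p. 217
  (held text `paper:doi-10-1090-s0002-9947-1968-0217093-3`, p0010).
-/

universe u v

namespace Literature.RingTheory.Flat

namespace Schlessinger34Remark

open TensorProduct

variable {A' : Type u} {A : Type v} [CommRing A'] [CommRing A] [Algebra A' A]

/-- `u' : M' = A' → M = A`, «`u'` = inclusion» (`A' ⊂ A`), as a map semilinear over `algebraMap A' A`.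
[cite: Schlessinger1968, Remark p. 217] -/
def inclusion : A' →ₛₗ[algebraMap A' A] A where
  toFun := algebraMap A' A
  map_add' := map_add _
  map_smul' r x := by rw [smul_eq_mul, map_mul, smul_eq_mul]

/-- `inclusion` on elements. [cite: Schlessinger1968, Remark p. 217] -/
@[simp] theorem inclusion_apply (x : A') : inclusion (A := A) x = algebraMap A' A x := rfl

/-- `u'' : M'' = A' → M = A`, «`u''` = multiplication by `a⁻¹`» (after the inclusion): `x ↦ c · x` in `A`.
[cite: Schlessinger1968, Remark p. 217] -/
def mulInclusion (c : A) : A' →ₛₗ[algebraMap A' A] A where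
  toFun x := c * algebraMap A' A x
  map_add' x y := by rw [map_add, mul_add]
  map_smul' r x := by rw [smul_eq_mul, map_mul, smul_eq_mul, mul_left_comm]

/-- `mulInclusion c` on elements. [cite: Schlessinger1968, Remark p. 217] -/
@[simp] theorem mulInclusion_apply (c : A) (x : A') : mulInclusion c x = c * algebraMap A' A x := rfl

/-- «Then `B ≅ A'`»: with `A' = A'' → A` both the (injective) inclusion, `A'` itself — over `A'` and `A''` by the
identity — is the fibre product `A' ×_A A''` (compatible pairs `(b, a)`, `b = a` in `A`, lift uniquely to `d = b`):
the cartesian-square hypotheses `hc`, `hcu` of `FiberProductFreeModule.lean` for `R₃ := A'`.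
[cite: Schlessinger1968, Remark p. 217] -/
theorem cartesian_of_injective (hι : Function.Injective (algebraMap A' A)) :
    (∀ (b a : A'), algebraMap A' A b = algebraMap A' A a →
      ∃ d : A', algebraMap A' A' d = b ∧ algebraMap A' A' d = a) ∧
    (∀ d d' : A', algebraMap A' A' d = algebraMap A' A' d' → algebraMap A' A' d = algebraMap A' A' d' → d = d') :=
  ⟨fun b _ h => ⟨b, rfl, hι h⟩, fun _ _ h _ => h⟩

variable (A') (a : Aˣ)

/-- **`N = M' ×_M M''`** of the Remark: the pairs `(m', m'') ∈ A' × A'` with `m' = a⁻¹ m''` in `A`, a module over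
`B = A' ×_A A' ≅ A'` (`R₃ := A'`). [cite: Schlessinger1968, Remark p. 217] -/
abbrev remarkN : Submodule A' (A' × A') :=
  fiberProd A' (inclusion (A' := A') (A := A)) (mulInclusion (A' := A') (↑a⁻¹ : A))

/-- Membership in `N`: `m' = a⁻¹ m''` in `A`. [cite: Schlessinger1968, Remark p. 217] -/
theorem mem_remarkN (m : A' × A') :
    m ∈ remarkN A' a ↔ algebraMap A' A m.1 = ↑a⁻¹ * algebraMap A' A m.2 := Iff.rfl

/-- **«the ideal `(aA') ∩ A'` of `A'`»** (pulled back along the inclusion): the `y ∈ A'` with `y = a x` in `A` for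
some `x ∈ A'`. [cite: Schlessinger1968, Remark p. 217] -/
def remarkIdeal : Ideal A' where
  carrier := {y | ∃ x : A', algebraMap A' A y = a * algebraMap A' A x}
  add_mem' := by
    rintro y y' ⟨x, hx⟩ ⟨x', hx'⟩
    exact ⟨x + x', by rw [map_add, map_add, hx, hx', mul_add]⟩
  zero_mem' := ⟨0, by rw [map_zero, mul_zero]⟩
  smul_mem' r y := by
    rintro ⟨x, hx⟩
    exact ⟨r * x, by rw [smul_eq_mul, map_mul, map_mul, hx, mul_left_comm]⟩

/-- Membership in `(aA') ∩ A'`. [cite: Schlessinger1968, Remark p. 217] -/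
theorem mem_remarkIdeal (y : A') : y ∈ remarkIdeal A' a ↔ ∃ x : A', algebraMap A' A y = a * algebraMap A' A x :=
  Iff.rfl

/-- `m' = a⁻¹ m''` iff `m'' = a m'` (in `A`). [cite: Schlessinger1968, Remark p. 217] -/
theorem eq_inv_mul_iff (p q : A) : p = ↑a⁻¹ * q ↔ q = a * p := by
  constructor
  · rintro rfl; rw [Units.mul_inv_cancel_left]
  · rintro rfl; rw [Units.inv_mul_cancel_left]

/-- The second projection `N → (aA') ∩ A'`, `(m', m'') ↦ m''` (`m'' = a m'`). [cite: Schlessinger1968, Remark p. 217] -/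
def sndToIdeal : remarkN A' a →ₗ[A'] remarkIdeal A' a where
  toFun n := ⟨(n : A' × A').2, (n : A' × A').1, (eq_inv_mul_iff a _ _).1 n.2⟩
  map_add' _ _ := rfl
  map_smul' _ _ := rfl

/-- `sndToIdeal` on elements. [cite: Schlessinger1968, Remark p. 217] -/
@[simp] theorem coe_sndToIdeal_apply (n : remarkN A' a) : (sndToIdeal A' a n : A') = (n : A' × A').2 := rfl

/-- For an INJECTIVE inclusion, `(m', m'') ↦ m''` is a bijection `N → (aA') ∩ A'` (`m'` is recovered from
`m' = a⁻¹ m''`). [cite: Schlessinger1968, Remark p. 217] -/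
theorem sndToIdeal_bijective (hι : Function.Injective (algebraMap A' A)) :
    Function.Bijective (sndToIdeal A' a) := by
  constructor
  · intro n n' h
    have h2 : (n : A' × A').2 = (n' : A' × A').2 := congrArg (fun z : remarkIdeal A' a => (z : A')) h
    refine Subtype.ext (Prod.ext (hι ?_) h2)
    rw [(mem_remarkN A' a _).1 n.2, (mem_remarkN A' a _).1 n'.2, h2]
  · rintro ⟨y, x, hx⟩
    exact ⟨⟨(x, y), (eq_inv_mul_iff a _ _).2 hx⟩, rfl⟩

/-- **«`N ≅ (aA') ∩ A'`»** as `A'`-modules (= `B`-modules, `B ≅ A'`). [cite: Schlessinger1968, Remark p. 217] -/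
noncomputable def remarkEquiv (hι : Function.Injective (algebraMap A' A)) : remarkN A' a ≃ₗ[A'] remarkIdeal A' a :=
  LinearEquiv.ofBijective (sndToIdeal A' a) (sndToIdeal_bijective A' a hι)

/-- `remarkEquiv` on elements. [cite: Schlessinger1968, Remark p. 217] -/
@[simp] theorem coe_remarkEquiv_apply (hι : Function.Injective (algebraMap A' A)) (n : remarkN A' a) :
    (remarkEquiv A' a hι n : A') = (n : A' × A').2 := rfl

/-- The hypotheses of Lemma 3.4 that DO hold in the Remark: `M' = M'' = A'` are flat (indeed free of rank one)
over `A' = A''`. [cite: Schlessinger1968, Remark p. 217] -/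
theorem flat_factors : Module.Flat A' A' := inferInstance

/-- (ii) holds for `u'`: the inclusion induces `M' ⊗_{A'} A = A' ⊗_{A'} A ≅ A = M` (Mathlib `IsBaseChange`, read
through `restrictSemilinear` as in `FiberProductFreeModule.lean`). [cite: Schlessinger1968, Remark p. 217] -/
theorem isBaseChange_inclusion : IsBaseChange A (restrictSemilinear (inclusion (A' := A') (A := A))) := by
  have h : restrictSemilinear (inclusion (A' := A') (A := A)) = Algebra.linearMap A' A := LinearMap.ext fun _ => rfl
  rw [h]
  exact IsBaseChange.linearMap A' A

/-- (ii) holds for `u''`: multiplication by the unit `a⁻¹` (after the inclusion) induces `M'' ⊗_{A''} A ≅ A = M`.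
[cite: Schlessinger1968, Remark p. 217] -/
theorem isBaseChange_mulInclusion (c : Aˣ) :
    IsBaseChange A (restrictSemilinear (mulInclusion (A' := A') (c : A))) := by
  refine IsBaseChange.of_equiv
    ((IsBaseChange.linearMap A' A).equiv.trans (LinearEquiv.smulOfUnit c)) fun x => ?_
  rw [LinearEquiv.trans_apply, IsBaseChange.equiv_tmul, one_smul, restrictSemilinear_apply, mulInclusion_apply,
    Algebra.linearMap_apply]
  rfl

/-- **[Schlessinger1968, Remark p. 217]: «while `N ≅ (aA') ∩ A'` is not flat over `B`»** — whenever the ideal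
`(aA') ∩ A'` is not flat over `A'`, the `B = A'`-module `N = M' ×_M M''` built from `M' = M'' = A'` (flat),
`u'` = inclusion, `u''` = multiplication by `a⁻¹` ((ii) holds on both sides) is NOT flat: the conclusion of
Lemma 3.4 fails without the surjectivity hypothesis (i). [cite: Schlessinger1968, Remark p. 217] -/
theorem not_flat_remarkN (hι : Function.Injective (algebraMap A' A))
    (hI : ¬ Module.Flat A' (remarkIdeal A' a)) : ¬ Module.Flat A' (remarkN A' a) := fun _ =>
  hI (Module.Flat.of_linearEquiv (remarkEquiv A' a hι).symm)

/-! ## An instance of the recipe with square-zero algebras: `A' = k[ε] ↪ A = k[x, y]/(x, y)²`, `ε ↦ x`, `a = 1 + y` -/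

namespace Example

open TrivSqZeroExt

variable (k : Type u) [Field k]

/-- `A = k[x, y]/(x, y)²` as the trivial square-zero extension of `k` by `k² = kx ⊕ ky`. [folklore] -/
abbrev bigA : Type u := TrivSqZeroExt k (k × k)

/-- `A' = k[ε] ↪ A`, `ε ↦ x` (functoriality of `TrivSqZeroExt` along `inl : k → k × k`). [folklore] -/
def incl : TrivSqZeroExt k k →ₐ[k] bigA k := TrivSqZeroExt.map (LinearMap.inl k k k)

/-- `A` as an `A' = k[ε]`-algebra through `incl`. [folklore] -/
noncomputable instance algebraIncl : Algebra (TrivSqZeroExt k k) (bigA k) := (incl k).toRingHom.toAlgebra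

/-- The structure map IS `incl`. [folklore] -/
private theorem algebraMap_eq_incl (z : TrivSqZeroExt k k) : algebraMap (TrivSqZeroExt k k) (bigA k) z = incl k z := rfl

/-- Components of `incl z`: `(fst z; (snd z, 0))`. [folklore] -/
@[simp] private theorem fst_incl (z : TrivSqZeroExt k k) : (incl k z).fst = z.fst := fst_map _ _

/-- Components of `incl z`: `(fst z; (snd z, 0))`. [folklore] -/
@[simp] private theorem snd_incl (z : TrivSqZeroExt k k) : (incl k z).snd = (z.snd, 0) := snd_map _ _

/-- `incl` is injective: «let `A'` be a sublocal ring of the local ring `A`» — here `A' = k[ε] = k ⊕ kx ⊂ A = k ⊕ kx ⊕ ky`.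
[cite: Schlessinger1968, Remark p. 217] -/
theorem incl_injective : Function.Injective (algebraMap (TrivSqZeroExt k k) (bigA k)) := by
  intro z z' h
  rw [algebraMap_eq_incl, algebraMap_eq_incl] at h
  refine TrivSqZeroExt.ext (by rw [← fst_incl k z, h, fst_incl]) ?_
  have := congrArg TrivSqZeroExt.snd h
  rw [snd_incl, snd_incl, Prod.mk.injEq] at this
  exact this.1

/-- `incl` is NOT surjective (`y ∉ A'`): hypothesis (i) of Lemma 3.4 — the one the Remark drops («if neither `A'' → A`
nor `A' → A` is assumed surjective») — indeed fails here. [cite: Schlessinger1968, Remark p. 217] -/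
theorem not_surjective_incl : ¬ Function.Surjective (algebraMap (TrivSqZeroExt k k) (bigA k)) := by
  intro h
  obtain ⟨z, hz⟩ := h (inr (0, 1))
  have := congrArg TrivSqZeroExt.snd hz
  rw [algebraMap_eq_incl, snd_incl, snd_inr, Prod.mk.injEq] at this
  exact one_ne_zero this.2.symm

/-- The unit `a = 1 + y` of `A` (inverse `1 - y`, `y² = 0`). [folklore] -/
def unitA : (bigA k)ˣ where
  val := 1 + inr (0, 1)
  inv := 1 - inr (0, 1)
  val_inv := by
    rw [show ((1 + inr (0, 1)) * (1 - inr (0, 1)) : bigA k) = 1 - inr (0, 1) * inr (0, 1) by ring, inr_mul_inr,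
      sub_zero]
  inv_val := by
    rw [show ((1 - inr (0, 1)) * (1 + inr (0, 1)) : bigA k) = 1 - inr (0, 1) * inr (0, 1) by ring, inr_mul_inr,
      sub_zero]

/-- `a = 1 + y` on components. [folklore] -/
@[simp] private theorem fst_unitA : ((unitA k : (bigA k)ˣ) : bigA k).fst = 1 := by
  simp [unitA]

/-- `a = 1 + y` on components. [folklore] -/
@[simp] private theorem snd_unitA : ((unitA k : (bigA k)ˣ) : bigA k).snd = (0, 1) := by
  simp [unitA]

/-- `a · (α + βx) = α + βx + αy` in `A = k[x, y]/(x, y)²`: components. [folklore] -/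
private theorem unitA_mul_incl (z : TrivSqZeroExt k k) :
    ((unitA k : bigA k) * incl k z).fst = z.fst ∧ ((unitA k : bigA k) * incl k z).snd = (z.snd, z.fst) := by
  refine ⟨by rw [fst_mul, fst_unitA, fst_incl, one_mul], ?_⟩
  simp only [snd_mul, fst_unitA, snd_incl, snd_unitA, fst_incl, one_smul, op_smul_eq_smul, Prod.smul_mk,
    smul_zero, smul_eq_mul, mul_one, Prod.mk_add_mk, add_zero, zero_add]

/-- **`(aA') ∩ A' = (ε)`**: `α + βx + αy ∈ A' = k ⊕ kx` iff `α = 0`; so the ideal of the Remark is the square-zero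
ideal `kerIdeal = (ε) = {βε}` of `k[ε]` — «the ideal `(aA') ∩ A'` of `A'`» computed for this instance.
[cite: Schlessinger1968, Remark p. 217] -/
theorem remarkIdeal_example_eq : remarkIdeal (TrivSqZeroExt k k) (unitA k) = kerIdeal k k := by
  ext y
  rw [mem_remarkIdeal, mem_kerIdeal_iff_inr]
  constructor
  · rintro ⟨x, hx⟩
    rw [algebraMap_eq_incl, algebraMap_eq_incl] at hx
    have h2 := congrArg TrivSqZeroExt.snd hx
    rw [snd_incl, (unitA_mul_incl k x).2, Prod.mk.injEq] at h2
    have h1 := congrArg TrivSqZeroExt.fst hx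
    rw [fst_incl, (unitA_mul_incl k x).1] at h1
    refine TrivSqZeroExt.ext ?_ (by rw [snd_inr])
    rw [fst_inr, h1, ← h2.2]
  · intro hy
    refine ⟨y, TrivSqZeroExt.ext ?_ ?_⟩
    · simp only [algebraMap_eq_incl, (unitA_mul_incl k y).1, fst_incl]
    · simp only [algebraMap_eq_incl, (unitA_mul_incl k y).2, snd_incl, Prod.mk.injEq, true_and]
      rw [hy, fst_inr]

/-- In `k[ε]`, `ε · c = 0` forces `c ∈ (ε)` (`fst c = 0`). [folklore] -/
private theorem fst_eq_zero_of_eps_mul_eq_zero {c : TrivSqZeroExt k k} (h : (inr 1 : TrivSqZeroExt k k) * c = 0) :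
    c.fst = 0 := by
  have := congrArg TrivSqZeroExt.snd h
  rwa [snd_mul, fst_inr, zero_smul, zero_add, snd_inr, snd_zero, op_smul_eq_smul, smul_eq_mul, mul_one] at this

/-- Products inside `(ε)`: a coefficient in `(ε)` kills every element of `(ε)` (`(ε)² = 0`). [folklore] -/
private theorem smul_mem_kerIdeal_eq_zero {c : TrivSqZeroExt k k} (hc : c.fst = 0) (y : kerIdeal k k) : c • y = 0 := by
  refine Subtype.ext ?_
  rw [Submodule.coe_smul, Submodule.coe_zero, smul_eq_mul, (mem_kerIdeal_iff_inr _ _ _).1 y.2,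
    ← inl_fst_add_inr_snd_eq c, hc, inl_zero, zero_add, inr_mul_inr]

/-- **`(ε) ⊂ k[ε]` is NOT flat over `k[ε]`**: `ε · ε = 0` with `ε ≠ 0` in `(ε)`, and by Mathlib's equational
criterion (`Module.Flat.isTrivialRelation_of_sum_smul_eq_zero`) flatness would make this relation trivial —
`ε = Σ c_j y_j` with `ε c_j = 0`; but then `c_j ∈ (ε)` and `c_j y_j ∈ (ε)² = 0`, so `ε = 0`: absurd.
(Equivalently, as the Remark puts it, «not flat (= free) over `A'`»: over the Artin local ring `k[ε]` flat = free, and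
`(ε) ≅ k` is not free.) [cite: Schlessinger1968, Remark p. 217 («such that the ideal `(aA') ∩ A'` of `A'` is not
flat (= free) over `A'`»)] -/
theorem not_flat_kerIdeal : ¬ Module.Flat (TrivSqZeroExt k k) (kerIdeal k k) := by
  intro hflat
  let e : kerIdeal k k := ⟨inr 1, (mem_kerIdeal_iff_inr _ _ _).2 (by rw [snd_inr])⟩
  let f : Fin 1 → TrivSqZeroExt k k := fun _ => inr 1
  let x : Fin 1 → kerIdeal k k := fun _ => e
  have hrel : ∑ i : Fin 1, f i • x i = 0 := by
    rw [Fin.sum_univ_one]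
    exact smul_mem_kerIdeal_eq_zero k (fst_inr _ _) e
  obtain ⟨n, c, y, hy, hc⟩ :=
    Module.Flat.isTrivialRelation_of_sum_smul_eq_zero (R := TrivSqZeroExt k k) (M := kerIdeal k k) hrel
  have hc0 : ∀ j, (c 0 j).fst = 0 := fun j => by
    have h := hc j
    rw [Fin.sum_univ_one] at h
    exact fst_eq_zero_of_eps_mul_eq_zero k h
  have he0 : e = 0 := by
    have h0 : e = ∑ j, c 0 j • y j := hy 0
    rw [h0]
    exact Finset.sum_eq_zero fun j _ => smul_mem_kerIdeal_eq_zero k (hc0 j) (y j)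
  have h1 := congrArg (fun z : kerIdeal k k => (z : TrivSqZeroExt k k).snd) he0
  have h2 : ((e : kerIdeal k k) : TrivSqZeroExt k k).snd = (1 : k) := snd_inr _ _
  rw [h2, ZeroMemClass.coe_zero, snd_zero] at h1
  exact one_ne_zero h1

/-- **[Schlessinger1968, Remark p. 217], an explicit instance: `N = M' ×_M M''` is NOT flat over `B = A' = k[ε]`**
for `A' = k[ε] ↪ A = k[x, y]/(x, y)²` (`ε ↦ x`), `M' = M'' = A'` (free of rank one), `M = A`, `u'` = inclusion,
`u''` = multiplication by `a⁻¹`, `a = 1 + y` — although (ii) holds for both maps (`isBaseChange_inclusion`,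
`isBaseChange_mulInclusion`); only (i) fails (`not_surjective_incl`). [cite: Schlessinger1968, Remark p. 217] -/
theorem not_flat_remarkN_example : ¬ Module.Flat (TrivSqZeroExt k k) (remarkN (TrivSqZeroExt k k) (unitA k)) :=
  not_flat_remarkN _ (unitA k) (incl_injective k) (by rw [remarkIdeal_example_eq]; exact not_flat_kerIdeal k)

end Example

/-! ## The PRINTED instance: «In `C_Λ` one could take `A = k[t]/(t³)`, `A' = k[t²]`, `a = 1 + t`» (`C_Λ` = Artin local `Λ`-algebras, §1) -/

namespace PrintedExample

open Polynomial TrivSqZeroExt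

variable (k : Type u) [Field k]

/-- `A = k[t]/(t³)` (`AdjoinRoot (X³)` = `k[X] ⧸ (X³)`). [cite: Schlessinger1968, Remark p. 217] -/
abbrev A3 : Type u := AdjoinRoot ((X : k[X]) ^ 3)

/-- `t ∈ A = k[t]/(t³)` (the class of `X`). [cite: Schlessinger1968, Remark p. 217] -/
noncomputable def t : A3 k := AdjoinRoot.root ((X : k[X]) ^ 3)

/-- `t` is the class of `X`. [folklore] -/
private theorem t_eq_mk_X : t k = AdjoinRoot.mk ((X : k[X]) ^ 3) X := rfl

/-- `t³ = 0`. [cite: Schlessinger1968, Remark p. 217] -/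
theorem t_pow_three : t k ^ 3 = 0 := by
  rw [t_eq_mk_X, ← map_pow, AdjoinRoot.mk_self]

/-- `β ↦ β t²`, the `k`-linear map defining `A' = k[t²] = k ⊕ k t² → A`. [folklore] -/
noncomputable def toT2 : k →ₗ[k] A3 k := LinearMap.toSpanSingleton k (A3 k) (AdjoinRoot.mk _ (X ^ 2))

/-- `β ↦ β t²` as a class of polynomials. [folklore] -/
private theorem toT2_apply (β : k) : toT2 k β = AdjoinRoot.mk _ (C β * X ^ 2) := by
  rw [toT2, LinearMap.toSpanSingleton_apply, AdjoinRoot.smul_mk, Polynomial.smul_eq_C_mul]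

/-- `(x t²)(y t²) = xy t⁴ = 0`. [folklore] -/
private theorem toT2_mul_toT2 (x y : k) : toT2 k x * toT2 k y = 0 := by
  rw [toT2_apply, toT2_apply, ← map_mul, AdjoinRoot.mk_eq_zero]
  exact ⟨C x * C y * X, by ring⟩

/-- **`A' = k[t²] ↪ A = k[t]/(t³)`**: `k[t²] ⊂ k[t]/(t³)` is `k ⊕ k t²` with `(t²)² = t⁴ = 0`, i.e. the dual
numbers `k[ε]`, `ε ↦ t²` (`TrivSqZeroExt.liftEquivOfComm`). [cite: Schlessinger1968, Remark p. 217] -/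
noncomputable def incl3 : TrivSqZeroExt k k →ₐ[k] A3 k :=
  TrivSqZeroExt.liftEquivOfComm ⟨toT2 k, toT2_mul_toT2 k⟩

/-- `incl3 (α + βε) = α + β t²` as a class of polynomials. [cite: Schlessinger1968, Remark p. 217] -/
theorem incl3_apply (z : TrivSqZeroExt k k) : incl3 k z = AdjoinRoot.mk _ (C z.fst + C z.snd * X ^ 2) := by
  rw [incl3, liftEquivOfComm_apply, lift_def, Algebra.ofId_apply, AdjoinRoot.algebraMap_eq, map_add, toT2_apply]
  rfl

/-- `A = k[t]/(t³)` as an algebra over `A' = k[t²] = k[ε]` through `incl3`. [folklore] -/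
noncomputable instance algebraIncl3 : Algebra (TrivSqZeroExt k k) (A3 k) := (incl3 k).toRingHom.toAlgebra

/-- The structure map IS `incl3`. [folklore] -/
private theorem algebraMap_eq_incl3 (z : TrivSqZeroExt k k) :
    algebraMap (TrivSqZeroExt k k) (A3 k) z = incl3 k z := rfl

/-- `X³ ∣ p` iff the coefficients `0, 1, 2` of `p` vanish (`Polynomial.X_pow_dvd_iff`). [folklore] -/
private theorem X_pow_three_dvd_iff (p : k[X]) : X ^ 3 ∣ p ↔ p.coeff 0 = 0 ∧ p.coeff 1 = 0 ∧ p.coeff 2 = 0 := by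
  rw [Polynomial.X_pow_dvd_iff]
  constructor
  · intro h
    exact ⟨h 0 (by norm_num), h 1 (by norm_num), h 2 (by norm_num)⟩
  · rintro ⟨h0, h1, h2⟩ d hd
    interval_cases d <;> assumption

/-- `k[t²] → k[t]/(t³)` is injective («`A'` a sublocal ring of the local ring `A`»).
[cite: Schlessinger1968, Remark p. 217] -/
theorem incl3_injective : Function.Injective (algebraMap (TrivSqZeroExt k k) (A3 k)) := by
  intro z z' h
  rw [algebraMap_eq_incl3, algebraMap_eq_incl3, incl3_apply, incl3_apply, AdjoinRoot.mk_eq_mk,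
    X_pow_three_dvd_iff] at h
  obtain ⟨h0, -, h2⟩ := h
  simp only [coeff_sub, coeff_add, coeff_C, coeff_C_mul_X_pow, if_true] at h0 h2
  norm_num at h0 h2
  exact TrivSqZeroExt.ext (sub_eq_zero.1 h0) (sub_eq_zero.1 h2)

/-- … and NOT surjective (`t ∉ k[t²]`): hypothesis (i) of Lemma 3.4 fails, as the Remark intends.
[cite: Schlessinger1968, Remark p. 217] -/
theorem not_surjective_incl3 : ¬ Function.Surjective (algebraMap (TrivSqZeroExt k k) (A3 k)) := by
  intro h
  obtain ⟨z, hz⟩ := h (t k)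
  rw [algebraMap_eq_incl3, incl3_apply, t_eq_mk_X, AdjoinRoot.mk_eq_mk, X_pow_three_dvd_iff] at hz
  obtain ⟨-, h1, -⟩ := hz
  simp only [coeff_sub, coeff_add, coeff_C, coeff_C_mul_X_pow, coeff_X, if_true] at h1
  norm_num at h1

/-- **`a = 1 + t`**, a unit of `A = k[t]/(t³)` (inverse `1 - t + t²`, as `t³ = 0`).
[cite: Schlessinger1968, Remark p. 217] -/
noncomputable def unit3 : (A3 k)ˣ where
  val := 1 + t k
  inv := 1 - t k + t k ^ 2
  val_inv := by rw [show (1 + t k) * (1 - t k + t k ^ 2) = 1 + t k ^ 3 by ring, t_pow_three, add_zero]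
  inv_val := by rw [show (1 - t k + t k ^ 2) * (1 + t k) = 1 + t k ^ 3 by ring, t_pow_three, add_zero]

/-- `a = 1 + t` is the class of `1 + X`. [folklore] -/
private theorem coe_unit3 : ((unit3 k : (A3 k)ˣ) : A3 k) = AdjoinRoot.mk _ (1 + X) := by
  rw [map_add, map_one, ← t_eq_mk_X]
  rfl

/-- The polynomial identity behind «`(aA') ∩ A'`»: `(γ + δt²) − (1 + t)(α + βt²) = (γ−α) − αt + (δ−β)t² − βt³`.
[folklore] -/
private theorem key_poly (α β γ δ : k) :
    (C γ + C δ * X ^ 2 - (1 + X) * (C α + C β * X ^ 2) : k[X]) =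
      C (γ - α) + C (-α) * X + C (δ - β) * X ^ 2 + C (-β) * X ^ 3 := by
  simp only [map_sub, map_neg]
  ring

/-- The coefficients `0, 1, 2` of that polynomial. [folklore] -/
private theorem coeffs_key_poly (α β γ δ : k) :
    (C (γ - α) + C (-α) * X + C (δ - β) * X ^ 2 + C (-β) * X ^ 3 : k[X]).coeff 0 = γ - α ∧
    (C (γ - α) + C (-α) * X + C (δ - β) * X ^ 2 + C (-β) * X ^ 3 : k[X]).coeff 1 = -α ∧
    (C (γ - α) + C (-α) * X + C (δ - β) * X ^ 2 + C (-β) * X ^ 3 : k[X]).coeff 2 = δ - β := by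
  simp only [coeff_add, coeff_C, coeff_C_mul_X, coeff_C_mul_X_pow, if_true]
  norm_num

/-- **«the ideal `(aA') ∩ A'` of `A'`» for the printed instance is `(t²) = (ε) ⊂ k[t²] = k[ε]`:**
`(1 + t)(α + βt²) = α + αt + βt²` lies in `k[t²]` iff `α = 0`. [cite: Schlessinger1968, Remark p. 217] -/
theorem remarkIdeal_printed_eq : remarkIdeal (TrivSqZeroExt k k) (unit3 k) = kerIdeal k k := by
  ext y
  rw [mem_remarkIdeal, mem_kerIdeal_iff_inr]
  simp only [algebraMap_eq_incl3, incl3_apply, coe_unit3, ← map_mul, AdjoinRoot.mk_eq_mk, key_poly,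
    X_pow_three_dvd_iff, (coeffs_key_poly k _ _ _ _).1, (coeffs_key_poly k _ _ _ _).2.1,
    (coeffs_key_poly k _ _ _ _).2.2]
  constructor
  · rintro ⟨x, h0, h1, -⟩
    rw [neg_eq_zero] at h1
    rw [h1, sub_zero] at h0
    exact TrivSqZeroExt.ext (by rw [fst_inr, h0]) (by rw [snd_inr])
  · intro hy
    have h : y.fst = 0 := by rw [hy, fst_inr]
    exact ⟨y, by rw [sub_self], by rw [h, neg_zero], by rw [sub_self]⟩

/-- **[Schlessinger1968, Remark p. 217], THE PRINTED INSTANCE: for `A = k[t]/(t³) ⊃ A' = A'' = k[t²]`, `a = 1 + t`,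
`M' = M'' = A'`, `M = A`, `u'` = inclusion, `u''` = multiplication by `a⁻¹`, the `B ≅ A'`-module
`N = M' ×_M M'' ≅ (aA') ∩ A' = (t²)` is NOT flat** — (ii) holds on both sides (`isBaseChange_inclusion`,
`isBaseChange_mulInclusion`), only (i) fails (`not_surjective_incl3`). [cite: Schlessinger1968, Remark p. 217] -/
theorem not_flat_remarkN_printed :
    ¬ Module.Flat (TrivSqZeroExt k k) (remarkN (TrivSqZeroExt k k) (unit3 k)) :=
  not_flat_remarkN _ (unit3 k) (incl3_injective k)
    (by rw [remarkIdeal_printed_eq]; exact Example.not_flat_kerIdeal k)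

end PrintedExample

end Schlessinger34Remark

end Literature.RingTheory.Flat
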